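import Mathlib.Topology.Instances.ZMod
import Literature.NumberTheory.FaltingsSerre.ParamodularTemplate
import Literature.NumberTheory.FaltingsSerre.SymplecticLift
import Literature.NumberTheory.FaltingsSerre.S6Subgroups
import HarnessLib

/-!
# The integral symplectic `2`-adic Galois representation of a weight-2 paramodular eigenform of odd
# prime level with integer Euler factors, and its `𝔽₂`-residual representation (Brumer et al., §4.3)

[BPPTVY] = A. Brumer, A. Pacetti, C. Poor, G. Tornaría, J. Voight, D. S. Yuen, *On the paramodularity of
typical abelian surfaces*, Algebra & Number Theory **13**:5 (2019) 1145–1195 [cite: BrumerEtAl2019]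
(PRINTED numbering and pages throughout).

A NAMED FACT (`def … : Prop`, cited, not proved), companion of
`Literature.NumberTheory.Automorphic.Paramodular.BrumerEtAl2019.existsGaloisRep_weightTwo_primeLevel`
(`Automorphic/Paramodular/GaloisRepresentation.lean`: Thm 4.3.4 (iii)–(iv), values in `GL₄(ℚ̄_ℓ)`).  That
fact stops at `ℚ̄_ℓ`; the Faltings–Serre templates of this directory (`paramodular_of_galoisCertificate`,
`GaloisCertificate.lean`; `paramodular_of_surfaceCertificate`, `ParamodularTemplate.lean`) consume the
form side as a representation `ρ_f : Gal_ℚ → GSp₄(ℤ₂)` with similitude character `χ₂` (binders `ρf`,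
`PairCertificate.similitude₂`, `hρf_unr`, `hρf`) and its residual representation `ρ̄_f : Gal_ℚ → Sp₄(𝔽₂)`
(Step 1 of [Alg 2.4.1]).  The printed passage from `ℚ̄₂` to `ℤ₂` and `𝔽₂` is [§4.3, pp. 1170–1171]
(Lemma 4.3.6, Lemma 4.3.8) applied on [p. 1188]; this file transcribes exactly that passage, for the
case of every level treated in [BPPTVY] and in the certificate programme: `N` an odd prime, weight
`k = 2`, `ℓ = 2`, integer Euler factors.

## What is printed

**Theorem 4.3.4** (Taylor, Laumon, Weissauer, Schmidt, and Mok) [p. 1169]. "Let `f ∈ S_k(K(N))` be a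
Siegel paramodular newform of weight `k ≥ 2` and level `N`. Suppose that `f` is of type (G). Then for
any prime `ℓ ∤ N`, there exists a continuous, semisimple Galois representation
`ρ_{f,ℓ} : Gal_ℚ → GSp₄(ℚ_ℓ^al)` with the following properties: (i) `det(ρ_{f,ℓ}) = χ_ℓ^{4k-6}`; (ii) The
similitude character of `ρ_{f,ℓ}` is `χ_ℓ^{2k-3}`; (iii) `ρ_{f,ℓ}` is unramified outside `ℓN`;
(iv) `det(1 - ρ_{f,ℓ}(Frob_p)T) = Q_p(f,T)` for all `p ∤ ℓN` …".  [p. 1170]: "Mok's theorem relies on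
work of Arthur in a crucial way."  Then [p. 1170]: "Let `f` be as in Theorem 4.3.4 … By the Baire
category theorem, we may descend the representation to a finite extension `E' ⊆ ℚ_ℓ^al` of `ℚ_ℓ` …
Choose a stable `R'`-lattice … and reduce modulo `𝔩'`; the semisimplification yields a semisimple
residual representation `ρ̄^ss_{f,ℓ} : Gal_{ℚ,S} → GL₄(k')`, unique up to equivalence."

**Lemma 4.3.6** [p. 1170]. "The semisimplification `ρ̄^ss_{f,ℓ} : Gal_{ℚ,S} → GL₄(k')` is compatible with
a nondegenerate alternating form with similitude character `χ̄_ℓ^{2k-3}`; in particular, up to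
equivalence its image lies in `GSp₄(k')`."  (Proof: Serre 2018, Thm 5.1.4.)

**Lemma 4.3.8** [p. 1171]. "With hypotheses as in Theorem 4.3.4, the following statements hold: (a) The
semisimplified residual representation `ρ̄^ss_{f,ℓ}` descends to `ρ̄^ss_{f,ℓ} : Gal_{ℚ,S} → GSp₄(k)` up to
equivalence. (b) If `ρ̄^ss_{f,ℓ} = ρ̄_{f,ℓ}` is absolutely irreducible, then `ρ_{f,ℓ}` descends to
`ρ_{f,ℓ} : Gal_{ℚ,S} → GSp₄(E)` up to equivalence, where `E` is the extension of `ℚ_ℓ` generated by the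
Hecke eigenvalues of `f` as above" (`R` the valuation ring of `E`, `k` its residue field [p. 1171]; the
printed proof of (b) is Carayol [1994, Thm 2], which uses only `tr ρ_{f,ℓ}(Frob_p) = a_p(f) ∈ E`,
`p ∤ ℓN`).  Applied [p. 1188, after Lemma 7.1.4]: "we apply Lemma 4.3.8(b) to conclude that our
`2`-adic representations descend to `ρ_A, ρ_f : Gal_{ℚ,S} → GSp₄(ℤ₂)`", and [p. 1188, proof of
Thm 7.1.3]: "the residual representations have a common image `G := img ρ̄ ≤ GSp₄(𝔽₂) = Sp₄(𝔽₂)`".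
**Lemma 4.3.10** [p. 1172]. "Let `K` be the fixed field of `ker ρ̄_{f,ℓ}` and let `cond(ρ̄_{f,ℓ})` be
the Artin conductor of the representation `ρ̄_{f,ℓ}` of `Gal(K | ℚ)`. If `p ∥ N` is odd, then
`ord_p(cond(ρ̄_{f,ℓ})) ≤ 1`."  Used [proof of Prop 5.2.4, p. 1175]: "Decomposing the Weil–Deligne
representation at `p`, we see by Lemma 4.3.10 that the image of inertia is either trivial or a
`2 × 2`-Jordan block" (the tree's `GSp4F2.IsTransvection`, whose docstring cites this sentence).
**Prop 4.3.2** (Schmidt) [p. 1168] (type (G) ⟺ all reciprocal roots of `Q_p(f,T)` have absolute value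
`p^{k-3/2}` at one good `p`) and **§6.2** [p. 1179] ("There are no nontrivial weight 2 paramodular cusp
forms of level 1, so since 277 is prime, `f₂₇₇` is a newform") unfold "newform of type (G)" exactly as
in the companion fact.

## What is transcribed (special case; a COROLLARY of the printed statements, never stronger)
`BrumerEtAl2019.existsIntegralSymplecticGaloisRep_two_primeLevel`: `N` prime, `N ≠ 2`, `f ∈ S₂(K(N))`
not identically zero on `ℍ₂`, with spinor Euler factor `Q_p(f,T) = 1 - a_pT + b_pT² - pa_pT³ + p²T⁴`,
`a_p, b_p ∈ ℤ` (`lPolynomialOfSurface`, the shape (4.2.18) in weight `2`) at EVERY prime `p ≠ N` (so `f`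
is a `T(p)`-, `T₁(p²)`-eigenform there — `HasSpinorEulerFactorAt` — hence a newform, `N` being prime),
of type (G) at one `p₀ ≠ N`.  Here `ℓ = 2 ∤ N`, `E = ℚ₂` (integer `a_p`), `R = ℤ₂`, `k = 𝔽₂`, and
`χ̄₂ = 1`, `GSp₄(𝔽₂) = Sp₄(𝔽₂)`.  Conclusion: there is a continuous `σ̄ : Gal_ℚ → GL₄(𝔽₂)` — a model
over `𝔽₂` of `ρ̄^ss_{f,2}` — with
(a1) values in `Sp₄(𝔽₂) = ι(S₆)` for the tree's Gram matrix `J̄ = antiId4` (`GSp4F2.mem_range_iotaGL`;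
  all non-degenerate alternating forms on `𝔽₂⁴` are equivalent, so "up to equivalence in `GSp₄(k)`"
  [Lemma 4.3.8 (a)] may be read for this `J̄`);
(a2) `σ̄` unramified at every finite place `v ∤ 2N` [Thm 4.3.4 (iii)];
(a3) `charpoly σ̄(Frob_p) = (X⁴ Q_p(f,1/X)) mod 2` for `p ∤ 2N` [Thm 4.3.4 (iv); reduction and
  semisimplification preserve characteristic polynomials];
(a4) at every place over `N` (`N ∥ N`, odd) every inertia element acts through `1` or a transvection
  [Lemma 4.3.10 p. 1172 as used in the proof of Prop 5.2.4 p. 1175];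
(b) if `σ̄` is absolutely irreducible: a continuous `ρ : Gal_ℚ → GL₄(ℤ₂)` with
  `ρ(γ)ᵀ J ρ(γ) = χ₂(γ) J` for the tree's `J = antiIdAlt4 ℤ_[2]` (values in `GSp₄(ℤ₂)`, similitude
  character the `2`-adic cyclotomic character [Thm 4.3.4 (ii), `k = 2`; Lemma 4.3.8 (b); p. 1188]),
  unramified at `v ∤ 2N`, `charpoly ρ(Frob_p) = X⁴ Q_p(f,1/X)` for `p ∤ 2N`, and whose reduction
  `residual ρ` IS `σ̄` (when `ρ̄^ss` is absolutely irreducible the reduction of the descended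
  `GSp₄(ℤ₂)`-valued `ρ` is irreducible, hence is a model of `ρ̄^ss` over `𝔽₂` with values in `Sp₄(𝔽₂)`,
  and one takes `σ̄` to be it — [p. 1188]: "the residual representations have a common image").
`GSp₄` is read for the tree's Gram matrix `J = antiIdAlt4 ℤ_[2]` (the cell's `DIVERGENCE.md` D-22: over the
local ring `ℤ₂` every perfect alternating pairing on `ℤ₂⁴` has a symplectic basis, so "values in
`GSp₄(ℤ₂)` up to equivalence" [Lemma 4.3.8; p. 1188] holds for this `J` as for the printed one).
As in the companion fact, `HasFrobCharpolyAt` is about ARITHMETIC Frobenius [§2.1]; (i), (v),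
semisimplicity and the general level/weight are not transcribed.  DEPENDS ON ARTHUR'S CLASSIFICATION
for `GSp₄` through Mok 2014 [p. 1170] (cell pub-arthur, papers/Langlands/langlands-arthur-audit): users
inherit that dependence.  Design record: the cell's `DIVERGENCE.md` D-29.

## What is deliberately NOT here
No claim that `σ̄` is conjugate to the residual representation of a given abelian surface (that is
Step 1 of [Alg 2.4.1], Lemma 7.1.4 — a CERTIFICATE datum, `PairCertificate.residual_conj`), no
Brauer-obstruction discussion [p. 1171], no statement for `E ≠ ℚ₂`.

## References
* [BPPTVY] Thm 4.3.4 p. 1169; p. 1170 (Arthur; Baire descent; `ρ̄^ss`); Lemma 4.3.6 p. 1170; Lemma 4.3.8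
  p. 1171; Lemma 4.3.10 p. 1172; proof of Prop 5.2.4 p. 1175; Prop 4.3.2 p. 1168; (4.2.18) p. 1167;
  §6.2 pp. 1178–1179; p. 1188. [cite: BrumerEtAl2019]
-/

noncomputable section

namespace Literature.NumberTheory.FaltingsSerre

open Matrix Equiv Field IsDedekindDomain Polynomial
open Literature.NumberTheory.GaloisRepresentations Literature.NumberTheory.FaltingsSerre.GSp4F2
  Literature.NumberTheory.Automorphic.Paramodular Literature.NumberTheory.Automorphic
open scoped NumberField

namespace BrumerEtAl2019

/-- **The integral symplectic `2`-adic Galois representation of a weight-2 paramodular eigenform of odd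
prime level with integer Euler factors, and its `𝔽₂`-residual representation** [BPPTVY, Thm 4.3.4
(Taylor–Laumon–Weissauer–Schmidt–Mok) (ii)–(iv) p. 1169, with Prop 4.3.2 and §6.2 unfolding "newform of
type (G)"; Lemma 4.3.6 p. 1170; Lemma 4.3.8 (a), (b) p. 1171; Lemma 4.3.10 p. 1172 as used on p. 1175;
applied on p. 1188], SPECIAL CASE `N` prime,
`N ≠ 2`, `k = 2`, `ℓ = 2`, `E = ℚ₂`.  Hypotheses (all printed): `f ∈ S₂(K(N))`, `f ≢ 0` on `ℍ₂`, spinor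
Euler factor `1 - a_pT + b_pT² - pa_pT³ + p²T⁴` with `a_p, b_p ∈ ℤ` at every prime `p ≠ N`, type (G) at
one `p₀ ≠ N` (roots of `Q_{p₀}` of absolute value `p₀^{-1/2}`).  Conclusion: a continuous
`σ̄ : Gal_ℚ → GL₄(𝔽₂)` (a model of `ρ̄^ss_{f,2}`) with values in `Sp₄(𝔽₂) = ι(S₆)`, unramified at the
finite places `v ∤ 2N`, `charpoly σ̄(Frob_p) = X⁴Q_p(f,1/X) mod 2` for `p ∤ 2N`, inertia at `N` acting
through `1` or transvections ("`2 × 2` Jordan block"); and, IF `σ̄` is absolutely irreducible, a continuous `ρ : Gal_ℚ → GL₄(ℤ₂)` with `ρ(γ)ᵀ J ρ(γ) = χ₂(γ) J` (`J = antiIdAlt4 ℤ_[2]`,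
`χ₂` the `2`-adic cyclotomic character), unramified at `v ∤ 2N`, `charpoly ρ(Frob_p) = X⁴Q_p(f,1/X)` for
`p ∤ 2N`, and `residual ρ = σ̄`.  DEPENDS ON ARTHUR'S CLASSIFICATION FOR `GSp₄` through Mok 2014 (module
docstring; cell pub-arthur).  A user takes `(h : existsIntegralSymplecticGaloisRep_two_primeLevel)` as an
explicit hypothesis. [cite: BrumerEtAl2019, Thm 4.3.4 p. 1169; Lemma 4.3.6 p. 1170; Lemma 4.3.8 p. 1171; Lemma 4.3.10 p. 1172; p. 1175; p. 1188] -/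
def existsIntegralSymplecticGaloisRep_two_primeLevel : Prop :=
  ∀ (N : ℕ) [Fact N.Prime], N ≠ 2 → ∀ (f : Matrix (Fin 2) (Fin 2) ℂ → ℂ),
    IsParamodularCuspForm N 2 f →
    (∃ Z ∈ siegelUpperHalfSpace 2, f Z ≠ 0) →
    ∀ (a b : ℕ → ℤ),
    (∀ p : ℕ, p.Prime → ¬ p ∣ N →
      HasSpinorEulerFactorAt 2 p f ((lPolynomialOfSurface p (a p) (b p)).map (Int.castRingHom ℂ))) →
    (∃ p₀ : ℕ, p₀.Prime ∧ ¬ p₀ ∣ N ∧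
      ∀ z : ℂ, ((lPolynomialOfSurface p₀ (a p₀) (b p₀)).map (Int.castRingHom ℂ)).IsRoot z →
        ‖z‖ = (Real.sqrt p₀)⁻¹) →
    ∃ σ : FramedGaloisRep ℚ (ZMod 2) 4,
      (∀ γ, σ γ ∈ iotaGL.range) ∧
      (∀ v : HeightOneSpectrum (𝓞 ℚ), ((2 : ℕ) : 𝓞 ℚ) ∉ v.asIdeal → ((N : ℕ) : 𝓞 ℚ) ∉ v.asIdeal →
        σ.IsUnramifiedAt v) ∧
      (∀ p : ℕ, p.Prime → ¬ p ∣ N → p ≠ 2 →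
        ∀ v : HeightOneSpectrum (𝓞 ℚ), ((p : ℕ) : 𝓞 ℚ) ∈ v.asIdeal →
          σ.HasFrobCharpolyAt v
            ((lPolynomialOfSurface p (a p) (b p)).reverse.map (Int.castRingHom (ZMod 2)))) ∧
      (∀ v : HeightOneSpectrum (𝓞 ℚ), ((N : ℕ) : 𝓞 ℚ) ∈ v.asIdeal →
        ∀ 𝔓 ∈ v.primesAbove, ∀ τ ∈ 𝔓.inertia (absoluteGaloisGroup ℚ),
          σ τ = 1 ∨ IsTransvection ((σ τ : GL (Fin 4) (ZMod 2)) : Matrix (Fin 4) (Fin 4) (ZMod 2))) ∧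
      (IsAbsIrreducible σ.toMonoidHom →
        ∃ ρ : FramedGaloisRep ℚ ℤ_[2] 4,
          (∀ γ, IsSimilitude (antiIdAlt4 ℤ_[2]) ((GaloisRep.cyclotomicCharacter ℚ 2 γ : ℤ_[2]ˣ) : ℤ_[2])
            ((ρ γ : GL (Fin 4) ℤ_[2]) : Matrix (Fin 4) (Fin 4) ℤ_[2])) ∧
          (∀ v : HeightOneSpectrum (𝓞 ℚ), ((2 : ℕ) : 𝓞 ℚ) ∉ v.asIdeal →
            ((N : ℕ) : 𝓞 ℚ) ∉ v.asIdeal → ρ.IsUnramifiedAt v) ∧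
          (∀ p : ℕ, p.Prime → ¬ p ∣ N → p ≠ 2 →
            ∀ v : HeightOneSpectrum (𝓞 ℚ), ((p : ℕ) : 𝓞 ℚ) ∈ v.asIdeal →
              ρ.HasFrobCharpolyAt v
                ((lPolynomialOfSurface p (a p) (b p)).reverse.map (Int.castRingHom ℤ_[2]))) ∧
          ∀ γ, residual ρ.toMonoidHom γ = σ γ)

end BrumerEtAl2019

/-- Restatement of `BrumerEtAl2019.existsIntegralSymplecticGaloisRep_two_primeLevel` with the
hypotheses as named arguments (the form the instance templates consume). [cite: BrumerEtAl2019, Thm 4.3.4 p. 1169; Lemma 4.3.8 p. 1171; p. 1188] -/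
theorem BrumerEtAl2019.existsIntegralSymplecticGaloisRep_two_primeLevel.elim
    (h : BrumerEtAl2019.existsIntegralSymplecticGaloisRep_two_primeLevel)
    {N : ℕ} [Fact N.Prime] (hN2 : N ≠ 2) {f : Matrix (Fin 2) (Fin 2) ℂ → ℂ}
    (hcusp : IsParamodularCuspForm N 2 f) (hne : ∃ Z ∈ siegelUpperHalfSpace 2, f Z ≠ 0)
    (a b : ℕ → ℤ)
    (hfe : ∀ p : ℕ, p.Prime → ¬ p ∣ N →
      HasSpinorEulerFactorAt 2 p f ((lPolynomialOfSurface p (a p) (b p)).map (Int.castRingHom ℂ)))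
    (hG : ∃ p₀ : ℕ, p₀.Prime ∧ ¬ p₀ ∣ N ∧
      ∀ z : ℂ, ((lPolynomialOfSurface p₀ (a p₀) (b p₀)).map (Int.castRingHom ℂ)).IsRoot z →
        ‖z‖ = (Real.sqrt p₀)⁻¹) :
    ∃ σ : FramedGaloisRep ℚ (ZMod 2) 4,
      (∀ γ, σ γ ∈ iotaGL.range) ∧
      (∀ v : HeightOneSpectrum (𝓞 ℚ), ((2 : ℕ) : 𝓞 ℚ) ∉ v.asIdeal → ((N : ℕ) : 𝓞 ℚ) ∉ v.asIdeal →
        σ.IsUnramifiedAt v) ∧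
      (∀ p : ℕ, p.Prime → ¬ p ∣ N → p ≠ 2 →
        ∀ v : HeightOneSpectrum (𝓞 ℚ), ((p : ℕ) : 𝓞 ℚ) ∈ v.asIdeal →
          σ.HasFrobCharpolyAt v
            ((lPolynomialOfSurface p (a p) (b p)).reverse.map (Int.castRingHom (ZMod 2)))) ∧
      (∀ v : HeightOneSpectrum (𝓞 ℚ), ((N : ℕ) : 𝓞 ℚ) ∈ v.asIdeal →
        ∀ 𝔓 ∈ v.primesAbove, ∀ τ ∈ 𝔓.inertia (absoluteGaloisGroup ℚ),
          σ τ = 1 ∨ IsTransvection ((σ τ : GL (Fin 4) (ZMod 2)) : Matrix (Fin 4) (Fin 4) (ZMod 2))) ∧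
      (IsAbsIrreducible σ.toMonoidHom →
        ∃ ρ : FramedGaloisRep ℚ ℤ_[2] 4,
          (∀ γ, IsSimilitude (antiIdAlt4 ℤ_[2]) ((GaloisRep.cyclotomicCharacter ℚ 2 γ : ℤ_[2]ˣ) : ℤ_[2])
            ((ρ γ : GL (Fin 4) ℤ_[2]) : Matrix (Fin 4) (Fin 4) ℤ_[2])) ∧
          (∀ v : HeightOneSpectrum (𝓞 ℚ), ((2 : ℕ) : 𝓞 ℚ) ∉ v.asIdeal →
            ((N : ℕ) : 𝓞 ℚ) ∉ v.asIdeal → ρ.IsUnramifiedAt v) ∧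
          (∀ p : ℕ, p.Prime → ¬ p ∣ N → p ≠ 2 →
            ∀ v : HeightOneSpectrum (𝓞 ℚ), ((p : ℕ) : 𝓞 ℚ) ∈ v.asIdeal →
              ρ.HasFrobCharpolyAt v
                ((lPolynomialOfSurface p (a p) (b p)).reverse.map (Int.castRingHom ℤ_[2]))) ∧
          ∀ γ, residual ρ.toMonoidHom γ = σ γ) :=
  h N hN2 f hcusp hne a b hfe hG

end Literature.NumberTheory.FaltingsSerre

end
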